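import Summits.BirchSwinnertonDyer.BirchSwinnertonDyer.Theorems.SignedLowerHalvesSmallImageLowerHalfBothSignsRttCharRoadE1KRigidityBaseChange
import HarnessLib

/-!
# Route `SignedLowerHalves`, crux L `SmallImageLowerHalfBothSigns` (stmt-BirchSwinnertonDyer-23599), line `rtt_w3` v12 — glue brick §2(c), THE FINITE PRIME-TO-`p`
# QUOTIENT `q` (input `q`/`hC`/`hqA` of `exists_injective_classMap_of_coprime`, p768467): under the stub's `hKU` (`ρ̄(Γ_K) ⊆ kˣ`) every subgroup `H ≤ Γ_K`
# acts on the `K`-side torsion `W_K[p] = geomTorsion (W.baseChange K) p` — hence on `A := Fin J → W_K[p]` — through `q : H →* kˣ = unitGroup k`,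
# `q = Φ ∘ ρ̄ ∘ res` corestricted, a finite group of order `p² − 1` prime to `p`; and `ker q` acts trivially.

Width seat `bsd-line-slh-p3-w3` g18 under LEAD `cruxlead-stmt-BirchSwinnertonDyer-23599` (cell `bsd-ssimc`; `--supports stmt-BirchSwinnertonDyer-23599 --as helper`).
THEOREMS ONLY (no definition, no named fact, no instance, no `sorry`; `q` is produced by `∃`). BSD / crux L / INJ_top are NOT proved here.

* `not_dvd_card_unitGroup` — `p ∤ #kˣ = p² − 1` (tree `card_unitGroup_eq`).
* `smul_eq_self_of_coords_eq_one` — if `Φ(ρ̄(res τ)) = 1` then `τ` acts trivially on `W_L[p]` (transported frame `coords_smul_baseChange`, p768789).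
* ★★ `exists_cartanQuotient_hom` — for every `H ≤ Γ_L`: `∃ q : H →* unitGroup k` with `(q h : GL₂) = Φ(ρ̄(res h))` and `q h = 1 ⟹ h` acts trivially on `W_L[p]`
  and on every `J → W_L[p]`.

References: [Serre1972] §2.1–2.2 (`#kˣ = p² − 1`); [SerreLinearRepresentations1977] §1.3 (Maschke needs `p ∤ #G`); [SerreGaloisCohomology1997] II §1.1.
-/

set_option autoImplicit false
set_option linter.dupNamespace false -- D-0017: single-problem summit, the namespace repeats the problem name by design
noncomputable section

open scoped Classical MatrixGroups

namespace Summit.BirchSwinnertonDyer.BirchSwinnertonDyer.Theorems.SmallImageCharSignedSelmer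

open Literature.NumberTheory.GaloisRepresentations Literature.NumberTheory.GaloisRepresentations.Serre1972
  Literature.NumberTheory.EllipticCurves WeierstrassCurve Matrix

section Card

variable {p : ℕ} [hp : Fact p.Prime]

/-- **`p ∤ #kˣ`**: the non-split Cartan `kˣ` has order `p² − 1`. [cite: Serre1972, §2.1] -/
theorem not_dvd_card_unitGroup {k : Subalgebra (ZMod p) (Matrix (Fin 2) (Fin 2) (ZMod p))} (hk : IsField k) (h2 : Module.finrank (ZMod p) k = 2) :
    ¬ p ∣ Nat.card (unitGroup k) := by
  rw [card_unitGroup_eq hk h2]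
  intro h
  have h1 : p ∣ p ^ 2 := dvd_pow_self p two_ne_zero
  have h3 : p ∣ p ^ 2 - (p ^ 2 - 1) := Nat.dvd_sub h1 h
  rw [Nat.sub_sub_self (Nat.one_le_pow 2 p hp.out.pos)] at h3
  exact hp.out.one_lt.ne' (Nat.dvd_one.1 h3)

end Card

section Quotient

variable {F : Type} [Field F] (L : Type) [Field L] [Algebra F L] [Algebra.IsAlgebraic F L]
  (W : WeierstrassCurve F) {p : ℕ} [Fact p.Prime]
  (Φ : Multiplicative (AddAut (geomTorsion W p)) ≃* GL (Fin 2) (ZMod p))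
  (k : Subalgebra (ZMod p) (Matrix (Fin 2) (Fin 2) (ZMod p))) (e₀ : geomTorsion W p ≃+ (Fin 2 → ZMod p))
  (he₀ : ∀ (g : Multiplicative (AddAut (geomTorsion W p))) (x : geomTorsion W p),
    e₀ (Multiplicative.toAdd g x) = ((Φ g : GL (Fin 2) (ZMod p)) : Matrix (Fin 2) (Fin 2) (ZMod p)) *ᵥ e₀ x)

include he₀ in
/-- If `Φ(ρ̄(res τ)) = 1` then `τ ∈ Γ_L` acts trivially on `W_L[p]` (read in the transported frame). [cite: SerreGaloisCohomology1997, II §1.1] -/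
theorem smul_eq_self_of_coords_eq_one {τ : Field.absoluteGaloisGroup L} (hτ : Φ (galoisRepTorsion W p (absGaloisRestrict F L τ)) = 1)
    (Q : geomTorsion (W.baseChange L) p) : τ • Q = Q := by
  apply ((torsionBaseChangeEquiv L W p).symm.trans e₀).injective
  rw [coords_smul_baseChange L W Φ e₀ he₀, hτ, Units.val_one, Matrix.one_mulVec]

include he₀ in
/-- ★★ **The finite prime-to-`p` quotient through which `H ≤ Γ_L` acts on `W_L[p]`.** Under `hKU` (`Φ(ρ̄(res τ)) ∈ kˣ` for all `τ ∈ Γ_L`) there is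
`q : H →* unitGroup k` with `(q h : GL₂) = Φ(ρ̄(res h))`; its kernel acts trivially on `W_L[p]` and on every `J → W_L[p]` (the coefficient module
`A := Fin J → geomTorsion (W.baseChange K) p` of §2(c)); `unitGroup k` is finite of order prime to `p` (`not_dvd_card_unitGroup`). [cite: Serre1972, §2.2] -/
theorem exists_cartanQuotient_hom (hKU : ∀ τ : Field.absoluteGaloisGroup L, Φ (galoisRepTorsion W p (absGaloisRestrict F L τ)) ∈ unitGroup k)
    (H : Subgroup (Field.absoluteGaloisGroup L)) :
    ∃ q : H →* unitGroup k,
      (∀ h : H, ((q h : unitGroup k) : GL (Fin 2) (ZMod p)) = Φ (galoisRepTorsion W p (absGaloisRestrict F L (h : Field.absoluteGaloisGroup L)))) ∧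
      (∀ h : H, q h = 1 → ∀ Q : geomTorsion (W.baseChange L) p, (h : Field.absoluteGaloisGroup L) • Q = Q) ∧
      (∀ h : H, q h = 1 → ∀ (J : Type) (f : J → geomTorsion (W.baseChange L) p), (h : Field.absoluteGaloisGroup L) • f = f) := by
  let f : H →* GL (Fin 2) (ZMod p) :=
    (Φ.toMonoidHom.comp (galoisRepTorsion W p)).comp ((absGaloisRestrict F L).toMonoidHom.comp H.subtype)
  have hf : ∀ h : H, f h = Φ (galoisRepTorsion W p (absGaloisRestrict F L (h : Field.absoluteGaloisGroup L))) := fun h ↦ rfl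
  let q : H →* unitGroup k := f.codRestrict (unitGroup k) fun h ↦ by rw [hf]; exact hKU _
  have hq : ∀ h : H, ((q h : unitGroup k) : GL (Fin 2) (ZMod p)) = Φ (galoisRepTorsion W p (absGaloisRestrict F L (h : Field.absoluteGaloisGroup L))) :=
    fun h ↦ rfl
  have hker : ∀ h : H, q h = 1 → Φ (galoisRepTorsion W p (absGaloisRestrict F L (h : Field.absoluteGaloisGroup L))) = 1 := fun h hh ↦ by
    rw [← hq, hh]; rfl
  refine ⟨q, hq, fun h hh Q ↦ smul_eq_self_of_coords_eq_one L W Φ e₀ he₀ (hker h hh) Q, fun h hh J g ↦ ?_⟩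
  funext j
  rw [Pi.smul_apply]
  exact smul_eq_self_of_coords_eq_one L W Φ e₀ he₀ (hker h hh) (g j)

end Quotient

end Summit.BirchSwinnertonDyer.BirchSwinnertonDyer.Theorems.SmallImageCharSignedSelmer

end
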